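import Literature.AlgebraicGeometry.GroupSchemes.BTGroupNilpotentPoints          -- ★ p844872: `BTGroup`, `specOver`, `IsConnectedDimOne`
import Literature.AlgebraicGeometry.GroupSchemes.AffineGroupSchemeHopfAlgebra     -- ★ p844646: `AffineGroupScheme.Alg`, `ptEquiv`, `ptEquiv_comap`
import Literature.RingTheory.PrincipalIdealRing.MonogenicTowerCoordinates         -- ★ p844858: `exists_compatible_generators`, `exists_algEquiv_quotient_X_pow_apply_mk`
import Literature.RingTheory.FormalGroups.TruncatedPolynomialNilpotentPoints       -- ★ p844916: `TruncatedPolynomial.algHomEquiv`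
import Mathlib.RingTheory.AdjoinRoot
import HarnessLib

/-!
# Natural nilpotent coordinates on a connected one-dimensional `p`-divisible group over a field
# ([Tate 1967] §2.2, proof of Prop. 1 — the scheme side of «connected BT groups are formal Lie groups»)

Topic `Literature/AlgebraicGeometry/GroupSchemes`; namespace `Literature.AlgebraicGeometry.GroupSchemes`.  THEOREMS ONLY (no definition,
no named fact, no instance, no notation, no `sorry`).  Cell `hodgecm-mathlib`, P6 «MOD programme», sub-desk F0P6d, sub-line 2
`Cruxes/HLiu418/Lines/F0_P6d_ConnectedBTDictionary.lean`, letter (HL-D) `ConnectedDimOneIsOModuleLaw`, half **(S) «scheme side»** of the cut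
of record (F0P6-p06 (g0) σ1 PLAN 14:24:08Z ∕ desk F0P6d-plan (g0) 14:24:23Z): from `IsConnectedDimOne B` — every layer algebra is abstractly
`Γ(B.G n) ≃ₐ[k] k[X]⧸(X^{p^{nH}})` — produce a NATURAL COORDINATE SYSTEM
`c n R : (Spec R → B.G n over Spec k) ≃ {x ∈ R ∣ x ^ (p ^ (n H)) = 0}`, natural in the `k`-algebra `R` (the clause-3 shape of ★
`IsPTorsionOfLawVia`) and compatible with the transitions `incl n : B.G n ↪ B.G (n+1)`.  The other half (P1)–(P5) «coordinates ⇒ law +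
action + dictionary» (★ `GroupObjectLawsFromCoordinates` …) consumes exactly this `c` with its two clauses.  HC_CM is proved only modulo
the printed citations until rung 0 closes; nothing here is about HC.

THE PRINT.  [Tate1967] §2.2, proof of Prop. 1: for a connected `p`-divisible group `G = (G_ν)` over (here) a field, `G_ν = Spec A_ν` with
`A_ν` local Artin, the `i_ν` induce surjections `A_{ν+1} ↠ A_ν`, and «we can choose the isomorphisms `A_ν ≈ R[[X₁,…,Xₙ]]⧸…` compatibly»;
a point of `G_ν` with values in `R` is then an `n`-tuple of nilpotent elements of `R` (here `n = 1`).  [Messing1972] Ch. II (3.3.18) for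
the general base.  [GortzWedhorn2023] (27.1.1), §(27.2): points of affine schemes over `Spec k` are `k`-algebra maps (★ `ptEquiv`).

THE ROUTE.  §1 a `k`-algebra `A` with `A ≃ₐ[k] k[X]⧸(X^N)`, `N ≠ 0`, is LOCAL with principal maximal ideal, residue field `k`
(elementwise) and `finrank_k A = N` (units∕nilpotents bookkeeping on `t = c + X̄·s`); §2 the layers `B.G n` are affine (finite over
`Spec k`), the exponents `p^{nH}` are `≠ 0` (the unit section forbids `Γ(B.G n) = 0`), the restrictions `Γ(B.G (n+1)) ↠ Γ(B.G n)` along the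
closed immersions `incl n` are surjective `k`-algebra maps, and the algebra map of a composite point `u ≫ v` is `(alg. map of u) ∘ Γ(v)`
(`ptEquiv_comp_apply`); §3 ★ `exists_compatible_generators` + ★ `exists_algEquiv_quotient_X_pow_apply_mk` give generators `x n ∈ Γ(B.G n)`
with `Γ(incl n)(x (n+1)) = x n` and coordinates `k[X]⧸(X^{p^{nH}}) ≃ₐ[k] Γ(B.G n)`, `X̄ ↦ x n` (exponent pinned by `finrank`); the
coordinate of a point `f` is `(ptEquiv f)(x n)` — **`exists_naturalCoordinates_of_isConnectedDimOne`** (with the generators exposed) and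
**`exists_coordinates_of_isConnectedDimOne`** (the two-clause form the dictionary half consumes).

## References
* [Tate1967] J. T. Tate, *p-divisible groups*, Proc. Conf. Local Fields (Driebergen, 1966), Springer (1967) — §2.2, proof of Prop. 1.
* [Messing1972] W. Messing, *The Crystals Associated to Barsotti–Tate Groups*, LNM 264 (1972) — Ch. II, (3.3.18).
* [GortzWedhorn2023] U. Görtz, T. Wedhorn, *Algebraic Geometry II* (2023) — (27.1.1), §(27.2) (pp. 606–607).
* [AtiyahMacdonald1969] M. F. Atiyah, I. G. Macdonald, *Introduction to Commutative Algebra* (1969) — Ch. 8, Prop. 8.8.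
-/

set_option autoImplicit false

-- Mathlib's `Over`/`Scheme` APIs are stated across semireducible wrappers (as in the ★ `GroupSchemes/*` files).
set_option backward.isDefEq.respectTransparency false

noncomputable section

universe u v

open AlgebraicGeometry CategoryTheory MonoidalCategory MonObj CartesianMonoidalCategory Polynomial IsLocalRing
open Literature.AlgebraicGeometry.Motives (algebraMapΓ)
open Literature.AlgebraicGeometry.Motives.AlgPoints (specOverMapOfAlgHom specOverMapOfAlgHom_left)

namespace Literature.AlgebraicGeometry.GroupSchemes

/-! ## §1 `k`-algebras abstractly isomorphic to `k[X]⧸(X^N)`: local, principal, residue field `k`, dimension `N` -/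

section Model

variable {k : Type u} [Field k] {A : Type v} [CommRing A] [Algebra k A] {N : ℕ}

/-- `k[X]⧸(X^N)` is a nontrivial ring for `N ≠ 0` (`X^N` is not a unit). [cite: AtiyahMacdonald1969, Ch. 8, Prop. 8.8 and Example] -/
theorem nontrivial_of_algEquiv_quotient_X_pow (ψ : A ≃ₐ[k] (k[X] ⧸ Ideal.span {(X : k[X]) ^ N})) (hN : N ≠ 0) : Nontrivial A := by
  haveI : Nontrivial (k[X] ⧸ Ideal.span {(X : k[X]) ^ N}) := by
    refine Ideal.Quotient.nontrivial_iff.mpr fun h => ?_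
    rw [Ideal.span_singleton_eq_top, (monic_X_pow N).isUnit_iff] at h
    exact hN (by simpa using congrArg natDegree h)
  exact ψ.toEquiv.nontrivial

/-- Every element of `A ≃ k[X]⧸(X^N)` is `c + x·s` with `c ∈ k` and `x` the image of `X̄` (from `g = g(0) + X·(g div X)`).
[cite: AtiyahMacdonald1969, Ch. 8, Prop. 8.8 and Example] -/
theorem exists_eq_algebraMap_add_mul_of_algEquiv_quotient_X_pow (ψ : A ≃ₐ[k] (k[X] ⧸ Ideal.span {(X : k[X]) ^ N})) (a : A) :
    ∃ (c : k) (s : A), a = algebraMap k A c + ψ.symm (Ideal.Quotient.mk _ X) * s := by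
  obtain ⟨g, hg⟩ := Ideal.Quotient.mk_surjective (ψ a)
  refine ⟨g.coeff 0, ψ.symm (Ideal.Quotient.mk _ g.divX), ?_⟩
  apply ψ.injective
  rw [map_add, map_mul, ψ.apply_symm_apply, ψ.apply_symm_apply, AlgEquiv.commutes, ← Ideal.Quotient.mk_algebraMap,
    Polynomial.algebraMap_eq, ← map_mul, ← map_add, ← hg, add_comm, X_mul_divX_add]

/-- The image `x` of `X̄` in `A ≃ k[X]⧸(X^N)` is nilpotent: `x^N = 0`. [cite: AtiyahMacdonald1969, Ch. 8, Prop. 8.8 and Example] -/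
theorem symm_mk_X_pow_eq_zero (ψ : A ≃ₐ[k] (k[X] ⧸ Ideal.span {(X : k[X]) ^ N})) :
    ψ.symm (Ideal.Quotient.mk _ X) ^ N = 0 := by
  rw [← map_pow, Literature.RingTheory.FormalGroups.TruncatedPolynomial.mk_X_pow_eq_zero, map_zero]

/-- **`A ≃ₐ[k] k[X]⧸(X^N)` (`N ≠ 0`) is a local ring**: `c + x·s` is a unit for `c ≠ 0` and `1 − x·s` is a unit.
[cite: AtiyahMacdonald1969, Ch. 8, Prop. 8.8 and Example] -/
theorem isLocalRing_of_algEquiv_quotient_X_pow (ψ : A ≃ₐ[k] (k[X] ⧸ Ideal.span {(X : k[X]) ^ N})) (hN : N ≠ 0) :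
    IsLocalRing A := by
  haveI := nontrivial_of_algEquiv_quotient_X_pow ψ hN
  refine IsLocalRing.of_isUnit_or_isUnit_one_sub_self fun a => ?_
  obtain ⟨c, s, rfl⟩ := exists_eq_algebraMap_add_mul_of_algEquiv_quotient_X_pow ψ a
  have hnil : IsNilpotent (ψ.symm (Ideal.Quotient.mk _ X) * s) :=
    Commute.isNilpotent_mul_right (Commute.all _ _) ⟨N, symm_mk_X_pow_eq_zero ψ⟩
  by_cases hc : c = 0
  · right
    rw [hc, map_zero, zero_add]
    exact hnil.isUnit_one_sub
  · left
    exact hnil.isUnit_add_left_of_commute ((isUnit_iff_ne_zero.mpr hc).map (algebraMap k A)) (Commute.all _ _)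

/-- **The maximal ideal of `A ≃ₐ[k] k[X]⧸(X^N)` is principal, generated by the image of `X̄`.**
[cite: AtiyahMacdonald1969, Ch. 8, Prop. 8.8 and Example] -/
theorem maximalIdeal_eq_span_of_algEquiv_quotient_X_pow [IsLocalRing A] (ψ : A ≃ₐ[k] (k[X] ⧸ Ideal.span {(X : k[X]) ^ N})) :
    maximalIdeal A = Ideal.span {ψ.symm (Ideal.Quotient.mk _ X)} := by
  refine le_antisymm (fun a ha => ?_) ?_
  · obtain ⟨c, s, rfl⟩ := exists_eq_algebraMap_add_mul_of_algEquiv_quotient_X_pow ψ a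
    have hnil : IsNilpotent (ψ.symm (Ideal.Quotient.mk _ X) * s) :=
      Commute.isNilpotent_mul_right (Commute.all _ _) ⟨N, symm_mk_X_pow_eq_zero ψ⟩
    by_cases hc : c = 0
    · rw [hc, map_zero, zero_add]
      exact Ideal.mul_mem_right _ _ (Ideal.subset_span rfl)
    · exact absurd (hnil.isUnit_add_left_of_commute ((isUnit_iff_ne_zero.mpr hc).map (algebraMap k A)) (Commute.all _ _))
        ((IsLocalRing.mem_maximalIdeal _).mp ha)
  · rw [Ideal.span_le, Set.singleton_subset_iff]
    exact (IsLocalRing.mem_maximalIdeal _).mpr fun hu => hu.not_isNilpotent ⟨N, symm_mk_X_pow_eq_zero ψ⟩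

/-- **The residue field of `A ≃ₐ[k] k[X]⧸(X^N)` is `k`, elementwise**: every `a` is congruent to a scalar modulo `𝔪`.
[cite: AtiyahMacdonald1969, Ch. 8, Prop. 8.8 and Example] -/
theorem exists_sub_algebraMap_mem_maximalIdeal_of_algEquiv_quotient_X_pow [IsLocalRing A]
    (ψ : A ≃ₐ[k] (k[X] ⧸ Ideal.span {(X : k[X]) ^ N})) (a : A) : ∃ c : k, a - algebraMap k A c ∈ maximalIdeal A := by
  obtain ⟨c, s, rfl⟩ := exists_eq_algebraMap_add_mul_of_algEquiv_quotient_X_pow ψ a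
  refine ⟨c, ?_⟩
  rw [maximalIdeal_eq_span_of_algEquiv_quotient_X_pow ψ, add_sub_cancel_left]
  exact Ideal.mul_mem_right _ _ (Ideal.subset_span rfl)

/-- **`finrank_k A = N`** for `A ≃ₐ[k] k[X]⧸(X^N)` (Mathlib `finrank_quotient_span_eq_natDegree`). [cite: AtiyahMacdonald1969, Ch. 8, Prop. 8.8 and Example] -/
theorem finrank_eq_of_algEquiv_quotient_X_pow (ψ : A ≃ₐ[k] (k[X] ⧸ Ideal.span {(X : k[X]) ^ N})) : Module.finrank k A = N := by
  rw [ψ.toLinearEquiv.finrank_eq, finrank_quotient_span_eq_natDegree, natDegree_X_pow]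

/-- `A ≃ₐ[k] k[X]⧸(X^N)` (`N ≠ 0`) is a finite `k`-module, hence an Artinian ring. [cite: AtiyahMacdonald1969, Ch. 8, Prop. 8.8 and Example] -/
theorem isArtinianRing_of_algEquiv_quotient_X_pow (ψ : A ≃ₐ[k] (k[X] ⧸ Ideal.span {(X : k[X]) ^ N})) (hN : N ≠ 0) :
    IsArtinianRing A := by
  haveI : Module.Finite k A := Module.finite_of_finrank_pos (by rw [finrank_eq_of_algEquiv_quotient_X_pow ψ]; exact Nat.pos_of_ne_zero hN)
  exact IsArtinianRing.of_finite k A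

end Model

/-! ## §2 The layers of a BT group over a field: affine, nonzero, surjective transitions; algebra maps of composite points -/

section Layers

variable {k : Type u} [CommRing k]

/-- **The algebra map of a composite point**: for a `Spec k`-morphism `v : G ⟶ G′` of affine `k`-schemes and a point `u : Spec R → G`,
the `k`-algebra map of `u ≫ v` is `(alg. map of u) ∘ Γ(v)` (naturality of `X ≅ Spec Γ(X)`). [cite: GortzWedhorn2023, §(27.2) (p. 606)] -/
theorem ptEquiv_comp_apply {G G' : Over (Spec (.of k))} [IsAffine G.left] [IsAffine G'.left] {R : Type u} [CommRing R] [Algebra k R]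
    (u : specOver (A := k) R ⟶ G) (v : G ⟶ G') (y : AffineGroupScheme.Alg G') :
    AffineGroupScheme.ptEquiv G' R (u ≫ v) y = AffineGroupScheme.ptEquiv G R u (v.left.appTop.hom y) := by
  have h : CommRingCat.ofHom (AffineGroupScheme.ptEquiv G' R (u ≫ v)).toRingHom =
      v.left.appTop ≫ CommRingCat.ofHom (AffineGroupScheme.ptEquiv G R u).toRingHom := by
    rw [AffineGroupScheme.ofHom_ptEquiv, AffineGroupScheme.ofHom_ptEquiv]
    apply Spec.map_injective
    rw [Spec.map_preimage, Spec.map_comp, Spec.map_preimage, Over.comp_left, Category.assoc, Category.assoc,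
      Scheme.isoSpec_hom_naturality]
  exact congrArg (fun φ : CommRingCat.of (AffineGroupScheme.Alg G') ⟶ CommRingCat.of R => φ.hom y) h

variable {p H : ℕ} (B : BTGroup (Spec (.of k)) p H)

/-- The layers `B.G n → Spec k` of a BT group are finite, hence AFFINE schemes. [cite: Tate1967, §2 (2.1)] -/
theorem BTGroup.isAffine_left (n : ℕ) : IsAffine (B.G n).left := by
  haveI := B.isFinite n
  exact isAffine_of_isAffineHom (B.G n).hom

/-- **The restriction `Γ(incl n) : Γ(B.G (n+1)) → Γ(B.G n)` along the transition `incl n` is a `k`-ALGEBRA map** (the `Over` triangle).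
[cite: Tate1967, §2.2 (proof of Prop. 1)] -/
theorem BTGroup.appTop_incl_algebraMap (n : ℕ) (r : k) :
    (B.incl n).left.appTop.hom (algebraMap k (AffineGroupScheme.Alg (B.G (n + 1))) r) =
      algebraMap k (AffineGroupScheme.Alg (B.G n)) r := by
  have h : algebraMapΓ (B.G (n + 1)).hom ≫ (B.incl n).left.appTop = algebraMapΓ (B.G n).hom := by
    rw [Category.assoc, ← Scheme.Hom.comp_appTop, Over.w (B.incl n)]
  rw [AffineGroupScheme.Alg.algebraMap_eq, AffineGroupScheme.Alg.algebraMap_eq, ← h]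
  rfl

/-- **`Γ(incl n)` is SURJECTIVE** (a closed immersion into an affine scheme). [cite: Tate1967, §2.2 (proof of Prop. 1)] -/
theorem BTGroup.appTop_incl_surjective (n : ℕ) : Function.Surjective (B.incl n).left.appTop.hom := by
  haveI := B.isAffine_left (n + 1)
  haveI := B.isClosedImmersion_incl n
  exact (IsClosedImmersion.isAffine_surjective_of_isAffine (B.incl n).left).2

end Layers

section Field

variable {k : Type u} [Field k] {p H : ℕ} (B : BTGroup (Spec (.of k)) p H)

/-- **The exponents are nonzero**: if `Γ(B.G n) ≃ k[X]⧸(X^{p^{nH}})` then `p^{nH} ≠ 0` — otherwise `Γ(B.G n) = k[X]⧸(1) = 0`, but the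
unit section `Spec k → B.G n` gives a ring map `Γ(B.G n) → Γ(Spec k) ≅ k` into a nonzero ring. [cite: Tate1967, §2.2] -/
theorem BTGroup.pow_ne_zero_of_isConnectedDimOne (hB : IsConnectedDimOne B) (n : ℕ) : p ^ (n * H) ≠ 0 := by
  intro h0
  letI : Algebra k Γ((B.G n).left, ⊤) := ((Scheme.ΓSpecIso (.of k)).inv ≫ (B.G n).hom.appTop).hom.toAlgebra
  obtain ⟨ψ⟩ := hB n
  rw [h0, pow_zero, Ideal.span_singleton_one] at ψ
  haveI : Subsingleton (k[X] ⧸ (⊤ : Ideal k[X])) := Ideal.Quotient.subsingleton_iff.mpr rfl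
  haveI : Subsingleton Γ((B.G n).left, ⊤) := ψ.toEquiv.subsingleton
  letI := B.grpObj n
  haveI : Nontrivial Γ((𝟙_ (Over (Spec (CommRingCat.of k)))).left, ⊤) := by
    change Nontrivial Γ(Spec (CommRingCat.of k), ⊤)
    exact (Scheme.ΓSpecIso (CommRingCat.of k)).commRingCatIsoToRingEquiv.surjective.nontrivial
  haveI : Nontrivial Γ((B.G n).left, ⊤) := (η[B.G n]).left.appTop.hom.domain_nontrivial
  exact false_of_nontrivial_of_subsingleton Γ((B.G n).left, ⊤)

/-! ## §3 Natural coordinates -/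

/-- **NATURAL COORDINATES ON A CONNECTED ONE-DIMENSIONAL BT GROUP OVER A FIELD, with the generators.**  If every layer algebra of
`B` is abstractly `k[X]⧸(X^{p^{nH}})` (`IsConnectedDimOne B`), there are generators `x n ∈ Γ(B.G n)` of the maximal ideals, COMPATIBLE
along the transitions (`Γ(incl n)(x (n+1)) = x n`), coordinates `θ n : k[X]⧸(X^{p^{nH}}) ≃ₐ[k] Γ(B.G n)` with `θ n X̄ = x n`, and bijections
`c n R : (Spec R → B.G n over Spec k) ≃ {r ∈ R ∣ r^{p^{nH}} = 0}` for every `k`-algebra `R`, given by `f ↦ (alg. map of f)(x n)` — hence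
natural in `R` and compatible with `incl n`. [cite: Tate1967, §2.2 (proof of Prop. 1)] [cite: Messing1972, Ch. II (3.3.18)] -/
theorem BTGroup.exists_naturalCoordinates_of_isConnectedDimOne (hB : IsConnectedDimOne B) :
    ∃ (x : ∀ n, AffineGroupScheme.Alg (B.G n))
      (θ : ∀ n, (k[X] ⧸ Ideal.span {(X : k[X]) ^ (p ^ (n * H))}) ≃ₐ[k] AffineGroupScheme.Alg (B.G n))
      (c : ∀ (n : ℕ) (R : Type u) [CommRing R] [Algebra k R], (specOver (A := k) R ⟶ B.G n) ≃ {x : R // x ^ (p ^ (n * H)) = 0}),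
      (∀ n, (B.incl n).left.appTop.hom (x (n + 1)) = x n) ∧
      (∀ n, θ n (Ideal.Quotient.mk _ X) = x n) ∧
      (∀ (n : ℕ) (R : Type u) [CommRing R] [Algebra k R] (f : specOver (A := k) R ⟶ B.G n),
        haveI := B.isAffine_left n; ((c n R) f).1 = AffineGroupScheme.ptEquiv (B.G n) R f (x n)) := by
  haveI hAff : ∀ n, IsAffine (B.G n).left := B.isAffine_left
  have hN : ∀ n, p ^ (n * H) ≠ 0 := B.pow_ne_zero_of_isConnectedDimOne hB
  -- the given abstract coordinates, on the carrier `Alg (B.G n) = Γ(B.G n)` with its structure-map algebra structure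
  have ψ : ∀ n, AffineGroupScheme.Alg (B.G n) ≃ₐ[k] (k[X] ⧸ Ideal.span {(X : k[X]) ^ (p ^ (n * H))}) := fun n => (hB n).some
  haveI : ∀ n, IsLocalRing (AffineGroupScheme.Alg (B.G n)) := fun n => isLocalRing_of_algEquiv_quotient_X_pow (ψ n) (hN n)
  haveI : ∀ n, IsArtinianRing (AffineGroupScheme.Alg (B.G n)) := fun n => isArtinianRing_of_algEquiv_quotient_X_pow (ψ n) (hN n)
  -- the transition algebra maps
  let π : ∀ n, AffineGroupScheme.Alg (B.G (n + 1)) →ₐ[k] AffineGroupScheme.Alg (B.G n) := fun n =>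
    { toRingHom := (B.incl n).left.appTop.hom, commutes' := B.appTop_incl_algebraMap n }
  have hπ : ∀ n, Function.Surjective (π n) := fun n => B.appTop_incl_surjective n
  -- compatible generators and coordinates at them
  obtain ⟨x, hx, hπx⟩ := Literature.RingTheory.PrincipalIdealRing.exists_compatible_generators
    (fun n => AffineGroupScheme.Alg (B.G n)) (fun n => (π n).toRingHom) hπ
    (fun n => ⟨ψ n |>.symm (Ideal.Quotient.mk _ X), by
      rw [maximalIdeal_eq_span_of_algEquiv_quotient_X_pow (ψ n), Ideal.submodule_span_eq]⟩)
  have hφ := fun n => Literature.RingTheory.PrincipalIdealRing.exists_algEquiv_quotient_X_pow_apply_mk (k := k) (hx n)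
    (exists_sub_algebraMap_mem_maximalIdeal_of_algEquiv_quotient_X_pow (ψ n))
  choose φ hφ using hφ
  -- the exponent is `p^{nH}` (dimension count)
  have hcl : ∀ n, nilpotencyClass (x n) = p ^ (n * H) := fun n => by
    rw [← finrank_eq_of_algEquiv_quotient_X_pow (φ n).symm, finrank_eq_of_algEquiv_quotient_X_pow (ψ n)]
  let θ : ∀ n, (k[X] ⧸ Ideal.span {(X : k[X]) ^ (p ^ (n * H))}) ≃ₐ[k] AffineGroupScheme.Alg (B.G n) := fun n =>
    (Ideal.quotientEquivAlgOfEq k (by rw [hcl n])).trans (φ n)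
  have hθ : ∀ n, θ n (Ideal.Quotient.mk _ X) = x n := fun n => by
    simp only [θ, AlgEquiv.trans_apply, Ideal.quotientEquivAlgOfEq_mk, hφ]
  refine ⟨x, θ, fun n R _ _ => ((AffineGroupScheme.ptEquiv (B.G n) R).trans ((θ n).symm.arrowCongr AlgEquiv.refl)).trans
      (Literature.RingTheory.FormalGroups.TruncatedPolynomial.algHomEquiv k (p ^ (n * H)) R), hπx, hθ, fun n R _ _ f => ?_⟩
  simp only [Equiv.trans_apply, Literature.RingTheory.FormalGroups.TruncatedPolynomial.algHomEquiv_apply, AlgEquiv.arrowCongr,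
    Equiv.coe_fn_mk, AlgHom.comp_apply, AlgEquiv.coe_toAlgHom, AlgEquiv.symm_symm, AlgEquiv.coe_refl, id_eq, hθ]

/-- **NATURAL COORDINATES ON A CONNECTED ONE-DIMENSIONAL BT GROUP OVER A FIELD** — the two-clause form the dictionary half of (HL-D)
consumes: bijections `c n R : (Spec R → B.G n over Spec k) ≃ {r ∈ R ∣ r^{p^{nH}} = 0}`, NATURAL in the `k`-algebra `R` (clause-3 shape of
★ `IsPTorsionOfLawVia`) and COMPATIBLE WITH THE TRANSITIONS (`c (n+1) (f ≫ incl n) = c n f`). [cite: Tate1967, §2.2 (proof of Prop. 1)]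
[cite: Messing1972, Ch. II (3.3.18)] -/
theorem BTGroup.exists_coordinates_of_isConnectedDimOne (hB : IsConnectedDimOne B) :
    ∃ c : ∀ (n : ℕ) (R : Type u) [CommRing R] [Algebra k R], (specOver (A := k) R ⟶ B.G n) ≃ {x : R // x ^ (p ^ (n * H)) = 0},
      (∀ (n : ℕ) (R R' : Type u) [CommRing R] [Algebra k R] [CommRing R'] [Algebra k R'] (φ : R →ₐ[k] R')
          (g : specOver (A := k) R' ⟶ specOver (A := k) R), g.left = Spec.map (CommRingCat.ofHom φ.toRingHom) →
          ∀ f : specOver (A := k) R ⟶ B.G n, ((c n R') (g ≫ f)).1 = φ ((c n R) f).1) ∧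
      (∀ (n : ℕ) (R : Type u) [CommRing R] [Algebra k R] (f : specOver (A := k) R ⟶ B.G n),
          ((c (n + 1) R) (f ≫ B.incl n)).1 = ((c n R) f).1) := by
  haveI hAff : ∀ n, IsAffine (B.G n).left := B.isAffine_left
  obtain ⟨x, θ, c, hπx, -, hc⟩ := B.exists_naturalCoordinates_of_isConnectedDimOne hB
  refine ⟨c, fun n R R' _ _ _ _ φ g hg f => ?_, fun n R _ _ f => ?_⟩
  · have hg' : g = specOverMapOfAlgHom φ := Over.OverMorphism.ext (by rw [hg, specOverMapOfAlgHom_left])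
    rw [hc, hc, hg', AffineGroupScheme.ptEquiv_comap, AlgHom.comp_apply]
  · rw [hc, hc, ptEquiv_comp_apply, hπx]

end Field

end Literature.AlgebraicGeometry.GroupSchemes

end
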